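import Summits.Ventures.PercRepro.Night2FatZLoads
import Summits.Ventures.PercRepro.Night2FatYD1Twelve

/-!
# night-2: the two-planes regime — distance-2 lines lie in the spine; pairs without a basis point on the spine

In the NON-DEGENERATE two-planes regime (`H₀ = π₂ ∪ π₃` through the spine `L = clF R₁`, the points of each plane off `L`
of rank `≥ 3`):
* **`line_subset_spine_of_dist_two_of_nondeg`**: the line of a distance-2 load above a basis pair lies in the spine (a point
  off `L` would force the other plane's points off `L` onto a line, `rkN_off_le_two_of_line_of_source_planes`);
* **`d1_of_two_planes_of_no_basis_point`**: a basis pair with NO basis point on the spine satisfies the distance-1 hypothesis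
  `hD1` (a distance-2 line `R ⊆ L ∩ (P₀ ∪ Y) ⊆ Y` would have `|R| = |Y| + 1 > |Y|`);
* **`basis_pair_fair_fat_of_two_planes_of_no_basis_point`**: hence such a pair has its fair share for every `N`
  (`basis_pair_fair_fat_of_card_sdiff_eq_four`, `…_of_D1_five/six/seven`, `…_of_D1_of_eight_le`).
Paper `proofs/NIGHT-2-g34.md` §6 (a).
-/

namespace PercRepro.Shadow

open PercRepro.ThmH PercRepro.PerFlat

variable {α : Type*} [DecidableEq α] {M : Matroid α} [M.Finite] {G : Finset α}

/-- **A distance-2 line above a basis pair lies in the spine** (non-degenerate two-planes regime). -/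
theorem line_subset_spine_of_dist_two_of_nondeg (hG : G ∈ flatsQ M (5 + 1))
    (hs : ∀ e ∈ gr M, ∀ f ∈ gr M, e ≠ f → rkN M {e, f} = 2) {w₀ x : α} {R₁ : Finset α}
    (hR₁V : R₁ ⊆ (G \ coloops M G) \ {w₀, x}) (hR₁2 : rkN M R₁ = 2) (hR₁3 : 3 ≤ R₁.card) {c₂ c₃ : α}
    (hc₂V : c₂ ∈ (G \ coloops M G) \ {w₀, x}) (hc₃V : c₃ ∈ (G \ coloops M G) \ {w₀, x})
    (hc₂ : c₂ ∉ clF M R₁) (hc₃ : c₃ ∉ clF M (insert c₂ R₁))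
    (hcover : ∀ e ∈ (G \ coloops M G) \ {w₀, x}, e ∈ clF M (insert c₂ R₁) ∨ e ∈ clF M (insert c₃ R₁))
    (hnd₂ : 3 ≤ rkN M (((G \ coloops M G) \ {w₀, x}).filter
      (fun e => e ∈ clF M (insert c₂ R₁) ∧ e ∉ clF M R₁)))
    (hnd₃ : 3 ≤ rkN M (((G \ coloops M G) \ {w₀, x}).filter
      (fun e => e ∈ clF M (insert c₃ R₁) ∧ e ∉ clF M R₁)))
    {T : Finset α} (hTG : T ⊆ G) {R : Finset α} (hR : R ⊆ (T \ coloops M G) \ {w₀, x}) (hR2 : rkN M R = 2)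
    (hR3 : 3 ≤ R.card) {c₂' c₃' : α} (hc₂'T : c₂' ∈ (T \ coloops M G) \ {w₀, x})
    (hc₃'T : c₃' ∈ (T \ coloops M G) \ {w₀, x}) (hc₂' : c₂' ∉ clF M R) (hc₃' : c₃' ∉ clF M (insert c₂' R))
    (hcover' : ∀ e ∈ (G \ coloops M G) \ {w₀, x}, e ∈ clF M (insert c₂' R) ∨ e ∈ clF M (insert c₃' R)) :
    R ⊆ clF M R₁ := by
  have hGg : G ⊆ gr M := (mem_flatsQ.1 hG).1
  have hVg : (G \ coloops M G) \ {w₀, x} ⊆ gr M := fun e he =>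
    hGg (Finset.mem_sdiff.1 (Finset.mem_sdiff.1 he).1).1
  have hR₁g : R₁ ⊆ gr M := hR₁V.trans hVg
  have hc₂g : c₂ ∈ gr M := hVg hc₂V
  have hc₃g : c₃ ∈ gr M := hVg hc₃V
  have hRV : R ⊆ (G \ coloops M G) \ {w₀, x} := fun r hr =>
    Finset.sdiff_subset_sdiff (Finset.sdiff_subset_sdiff hTG (Finset.Subset.refl _)) (Finset.Subset.refl _) (hR hr)
  have hRg : R ⊆ gr M := hRV.trans hVg
  have hRcover : ∀ e ∈ R, e ∈ clF M (insert c₂ R₁) ∨ e ∈ clF M (insert c₃ R₁) := fun e he => hcover e (hRV he)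
  have hS₂ : ∀ e ∈ ((G \ coloops M G) \ {w₀, x}).filter (fun e => e ∈ clF M (insert c₂ R₁) ∧ e ∉ clF M R₁),
      e ∈ clF M (insert c₂ R₁) ∧ e ∉ clF M R₁ := fun e he => (Finset.mem_filter.1 he).2
  have hS₃ : ∀ e ∈ ((G \ coloops M G) \ {w₀, x}).filter (fun e => e ∈ clF M (insert c₃ R₁) ∧ e ∉ clF M R₁),
      e ∈ clF M (insert c₃ R₁) ∧ e ∉ clF M R₁ := fun e he => (Finset.mem_filter.1 he).2
  have hc₂'g : c₂' ∈ gr M := hGg (hTG (Finset.mem_sdiff.1 (Finset.mem_sdiff.1 hc₂'T).1).1)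
  have hc₃'g : c₃' ∈ gr M := hGg (hTG (Finset.mem_sdiff.1 (Finset.mem_sdiff.1 hc₃'T).1).1)
  have hR₁cover' : ∀ e ∈ R₁, e ∈ clF M (insert c₂' R) ∨ e ∈ clF M (insert c₃' R) :=
    fun e he => hcover' e (hR₁V he)
  intro r hr
  by_contra hrL
  rcases subset_plane_of_rkN_le_two_of_cover hs hRg (by omega) hR3 hRcover with hRπ | hRπ
  · have hc₃L : c₃ ∉ clF M R₁ := fun h' => hc₃ (clF_mono (Finset.subset_insert _ _) h')
    have hc₂π₃ : c₂ ∉ clF M (insert c₃ R₁) := notMem_clF_insert_of_notMem_clF_insert hR₁g hc₂g hc₃g hc₂ hc₃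
    have := rkN_off_le_two_of_line_of_source_planes hs hR₁g hR₁2 hR₁3 hc₃g hc₂g hc₃L hc₂π₃ hRg hR2 hRπ hr hrL
      hc₂'g hc₃'g hc₂' hc₃' hS₃ (fun e he => hcover' e (Finset.mem_filter.1 he).1) hR₁cover'
    omega
  · have := rkN_off_le_two_of_line_of_source_planes hs hR₁g hR₁2 hR₁3 hc₂g hc₃g hc₂ hc₃ hRg hR2 hRπ hr hrL
      hc₂'g hc₃'g hc₂' hc₃' hS₂ (fun e he => hcover' e (Finset.mem_filter.1 he).1) hR₁cover'
    omega

/-- **A basis pair with no basis point on the spine satisfies the distance-1 hypothesis** (non-degenerate two-planes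
regime): a distance-2 line lies in the spine, hence inside `Y = (T ∖ Q) ∖ {x}`, against `|R| = |Y| + 1`. -/
theorem d1_of_two_planes_of_no_basis_point (hG : G ∈ flatsQ M (5 + 1)) (hd : (gr M \ G).card = 2)
    (hk : kColoops M G = 1) (hs : ∀ e ∈ gr M, ∀ f ∈ gr M, e ≠ f → rkN M {e, f} = 2)
    (hl : ∀ e ∈ gr M, M.Indep {e}) (hfat : (fatClosures M 5 G 2).card ≤ 1) {B₀ : Finset α}
    (hB₀ : B₀ ∈ thinMembers M 5 G) {w₀ x : α} (hD : G \ clF M B₀ = {w₀, x}) {R₁ : Finset α}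
    (hR₁V : R₁ ⊆ (G \ coloops M G) \ {w₀, x}) (hR₁2 : rkN M R₁ = 2) (hR₁3 : 3 ≤ R₁.card) {c₂ c₃ : α}
    (hc₂V : c₂ ∈ (G \ coloops M G) \ {w₀, x}) (hc₃V : c₃ ∈ (G \ coloops M G) \ {w₀, x})
    (hc₂ : c₂ ∉ clF M R₁) (hc₃ : c₃ ∉ clF M (insert c₂ R₁))
    (hcover : ∀ e ∈ (G \ coloops M G) \ {w₀, x}, e ∈ clF M (insert c₂ R₁) ∨ e ∈ clF M (insert c₃ R₁))
    (hnd₂ : 3 ≤ rkN M (((G \ coloops M G) \ {w₀, x}).filter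
      (fun e => e ∈ clF M (insert c₂ R₁) ∧ e ∉ clF M R₁)))
    (hnd₃ : 3 ≤ rkN M (((G \ coloops M G) \ {w₀, x}).filter
      (fun e => e ∈ clF M (insert c₃ R₁) ∧ e ∉ clF M R₁)))
    {B : Finset α} (hB : B ∈ thinMembers M 5 G) (hnP : ¬ bigP M G B) {z : α} (hz : z ∈ G \ clF M B)
    (hxQ : x ∉ insert z B) (hP₀ : ∀ a ∈ insert z B \ coloops M G, a ∉ clF M R₁) :
    ∀ T ∈ tgtSets M 5 G B z, x ∈ T → dload M 5 G (bigP M G) (dshGT2 M 5 G) T ≠ 0 →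
      ∃ R ⊆ (T \ coloops M G) \ {w₀, x}, rkN M R = 2 ∧ 3 ≤ R.card ∧ R.card + 4 = (T \ coloops M G).card ∧
        3 ≤ rkN M (G \ T) := by
  intro T hT hxT hload
  have hTG : T ⊆ G := subset_G_of_mem_shadowAt (mem_tgtSets.1 hT).1
  obtain ⟨R, hR, hR2, hR3, hcase⟩ := loaded_fat_target_dichotomy' hG hd hk hs hl hfat hB₀ hD hTG hload
  rcases hcase with ⟨hRc, hrk⟩ | ⟨hRc, -, c₂', hc₂'T, c₃', hc₃'T, hc₂', hc₃', hcover'⟩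
  · exact ⟨R, hR, hR2, hR3, hRc, hrk⟩
  · exfalso
    have hRL := line_subset_spine_of_dist_two_of_nondeg hG hs hR₁V hR₁2 hR₁3 hc₂V hc₃V hc₂ hc₃ hcover hnd₂ hnd₃
      hTG hR hR2 hR3 hc₂'T hc₃'T hc₂' hc₃' hcover'
    -- `R` lies inside `Y`
    have hRY : R ⊆ (T \ insert z B).erase x := by
      intro r hr
      have hr' := Finset.mem_sdiff.1 (hR hr)
      rw [Finset.mem_insert, Finset.mem_singleton, not_or] at hr'
      refine Finset.mem_erase.2 ⟨hr'.2.2, Finset.mem_sdiff.2 ⟨(Finset.mem_sdiff.1 hr'.1).1, ?_⟩⟩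
      intro hrQ
      exact hP₀ r (Finset.mem_sdiff.2 ⟨hrQ, (Finset.mem_sdiff.1 hr'.1).2⟩) (hRL hr)
    have hlev := card_sdiff_coloops_eq_level_add_five hG hd hk hB hnP hz hT
    have hxTQ : x ∈ T \ insert z B := Finset.mem_sdiff.2 ⟨hxT, hxQ⟩
    have hY : ((T \ insert z B).erase x).card + 1 = (T \ insert z B).card := by
      rw [Finset.card_erase_of_mem hxTQ]
      have : 0 < (T \ insert z B).card := Finset.card_pos.2 ⟨x, hxTQ⟩
      omega
    have := Finset.card_le_card hRY
    omega

/-- **The fair share of a basis pair with no basis point on the spine** (non-degenerate two-planes regime), every `N`. -/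
theorem basis_pair_fair_fat_of_two_planes_of_no_basis_point (hG : G ∈ flatsQ M (5 + 1))
    (hd : (gr M \ G).card = 2) (hk : kColoops M G = 1)
    (hs : ∀ e ∈ gr M, ∀ f ∈ gr M, e ≠ f → rkN M {e, f} = 2) (hl : ∀ e ∈ gr M, M.Indep {e})
    (hfat : (fatClosures M 5 G 2).card ≤ 1) {B₀ : Finset α} (hB₀ : B₀ ∈ thinMembers M 5 G) {w₀ x : α}
    (hD : G \ clF M B₀ = {w₀, x}) (hne : w₀ ≠ x) {R₁ : Finset α}
    (hR₁V : R₁ ⊆ (G \ coloops M G) \ {w₀, x}) (hR₁2 : rkN M R₁ = 2) (hR₁3 : 3 ≤ R₁.card) {c₂ c₃ : α}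
    (hc₂V : c₂ ∈ (G \ coloops M G) \ {w₀, x}) (hc₃V : c₃ ∈ (G \ coloops M G) \ {w₀, x})
    (hc₂ : c₂ ∉ clF M R₁) (hc₃ : c₃ ∉ clF M (insert c₂ R₁))
    (hcover : ∀ e ∈ (G \ coloops M G) \ {w₀, x}, e ∈ clF M (insert c₂ R₁) ∨ e ∈ clF M (insert c₃ R₁))
    (hnd₂ : 3 ≤ rkN M (((G \ coloops M G) \ {w₀, x}).filter
      (fun e => e ∈ clF M (insert c₂ R₁) ∧ e ∉ clF M R₁)))
    (hnd₃ : 3 ≤ rkN M (((G \ coloops M G) \ {w₀, x}).filter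
      (fun e => e ∈ clF M (insert c₃ R₁) ∧ e ∉ clF M R₁)))
    {B : Finset α} (hB : B ∈ thinMembers M 5 G) (hnP : ¬ bigP M G B) {z : α} (hz : z ∈ G \ clF M B)
    (hl0 : loss M 5 G B z ≠ 0) (hw₀ : w₀ ∈ insert z B) (hx : x ∉ insert z B)
    (hP₀ : ∀ a ∈ insert z B \ coloops M G, a ∉ clF M R₁) :
    loss M 5 G B z ≤ rhoL M 5 G B z * lossIncomeH M 5 G (bigP M G) (dshGT2 M 5 G) B z := by
  have hD1 := d1_of_two_planes_of_no_basis_point hG hd hk hs hl hfat hB₀ hD hR₁V hR₁2 hR₁3 hc₂V hc₃V hc₂ hc₃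
    hcover hnd₂ hnd₃ hB hnP hz hx hP₀
  have hN4 := four_le_card_sdiff_insert hG hd hB hz
  rcases Nat.lt_or_ge (G \ insert z B).card 5 with h5 | h5
  · exact basis_pair_fair_fat_of_card_sdiff_eq_four hG hd hk hs hl hfat hB₀ hD hne hB hnP hz hl0 hw₀ hx (by omega)
  rcases Nat.lt_or_ge (G \ insert z B).card 6 with h6 | h6
  · exact basis_pair_fair_fat_of_D1_five hG hd hk hs hl hfat hB₀ hD hne hB hnP hz hD1 hl0 hw₀ hx (by omega)
  rcases Nat.lt_or_ge (G \ insert z B).card 7 with h7 | h7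
  · exact basis_pair_fair_fat_of_D1_six hG hd hk hs hl hfat hB₀ hD hne hB hnP hz hD1 hl0 hw₀ hx (by omega)
  rcases Nat.lt_or_ge (G \ insert z B).card 8 with h8 | h8
  · exact basis_pair_fair_fat_of_D1_seven hG hd hk hs hl hfat hB₀ hD hne hB hnP hz hD1 hl0 hw₀ hx (by omega)
  exact basis_pair_fair_fat_of_D1_of_eight_le hG hd hk hs hl hfat hB₀ hD hne hB hnP hz hD1 hl0 hw₀ hx h8

end PercRepro.Shadow
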